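import Mathlib.NumberTheory.ArithmeticFunction.VonMangoldt
import Literature.NumberTheory.Sieve.AsymptoticSieveForPrimes
import HarnessLib

/-!
# Asymptotic sieve for primes: proof steps towards `fi_asymptotic_sieve_primes_loglog`

Trunk T-SIEVE. This sibling file of `Literature.NumberTheory.Sieve.AsymptoticSieveForPrimes` collects
PROVED steps of the proof of Friedlander–Iwaniec's Theorem 1 [FriedlanderIwaniecASP1998, Thm 1] in
the corrected form `Literature.NumberTheory.Sieve.fi_asymptotic_sieve_primes_loglog`, following the architecture of the printed
proof (FI §§2–3; G. Harman, *Prime-Detecting Sieves* (2007), §12.9, (12.9.18)–(12.9.36)):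

* reduction of (R), (B) to the `τ₅`-weighted (R′), (B′) (Harman (12.9.18)–(12.9.19); combinatorial
  input `Literature.NumberTheory.Sieve.Squarefree.exists_dvd_pow_le_card_divisors_le` in `SmallDivisorLemma`);
* Möbius–density cancellation from (1.9) (Harman (12.9.20));
* upper-bound sieve weights `ρ` (Harman p. 250);
* Vaughan's identity with splitting parameter `s` and smoothing (Harman (12.9.22)–(12.9.24);
  `Literature.NumberTheory.Sieve.vaughan_identity_add` in `CircleMethod`);
* the five term estimates `T(x;Y)`, `T(x;Y,Z)`, `S₁`, `S₂`, `S₃` (Harman (12.9.25)–(12.9.36));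
* **this file, first instalment**: the passage from `∑_{p ≤ x} a_p log p` to the tail sum
  `∑_{Z < n ≤ x} a_n Λ(n)` (Harman p. 250, first display: "`∑_{p≤x} a_p log p = ∑_{Z<n≤x} a_n Λ(n)
  + O(A(x)/log x)` by (12.9.2)"), valid for any `0 ≤ Z(x) ≤ √x` under the squarefree-support clause
  (1.16) and the growth clause (1.4) of `SieveSequence.FIAsymptoticSieveHypotheses`.

## Contents

* `FIAsymptoticSieveHypotheses.a_mul_vonMangoldt`: `a_n Λ(n) = a_n log n · [n prime]` ((1.16) kills
  proper prime powers);
* `FIAsymptoticSieveHypotheses.sum_Ioc_a_mul_vonMangoldt`: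
  `∑_{0 < n ≤ N} a_n Λ(n) = ∑_{p ≤ N} a_p log p`;
* `SieveSequence.congrSum_mono`, `SieveSequence.sum_primesLE_a_mul_log_le`
  (`∑_{p ≤ y} a_p log p ≤ log y · A(y)`);
* `FIAsymptoticSieveHypotheses.isBigO_sum_primes_sub_tail` (Harman p. 250):
  `∑_{p ≤ x} a_p log p - ∑_{Z(x) < n ≤ x} a_n Λ(n) = O(A(x) / log x)` for `0 ≤ Z(x) ≤ √x`.
-/

noncomputable section

open Filter Asymptotics Finset
open scoped ArithmeticFunction.vonMangoldt ArithmeticFunction.Moebius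

namespace Literature.NumberTheory.Sieve

namespace SieveSequence

variable {A : SieveSequence} {D δ Δ : ℝ → ℝ}

/-- `A_d(x)` is nondecreasing in `x` (nonnegative terms over a growing range). [folklore] -/
theorem congrSum_mono (A : SieveSequence) (d : ℕ) {x y : ℝ} (hxy : x ≤ y) :
    A.congrSum d x ≤ A.congrSum d y := by
  unfold congrSum
  refine Finset.sum_le_sum_of_subset_of_nonneg
    (Finset.filter_subset_filter _ (Finset.Ioc_subset_Ioc_right (Nat.floor_le_floor hxy)))
    fun n _ _ => A.a_nonneg n

/-- `A_d(x) ≥ 0`. [folklore] -/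
theorem congrSum_nonneg (A : SieveSequence) (d : ℕ) (x : ℝ) : 0 ≤ A.congrSum d x :=
  Finset.sum_nonneg fun n _ => A.a_nonneg n

/-- The trivial bound `∑_{p ≤ y} a_p log p ≤ log y · A(y)` for `y ≥ 1`. [folklore] -/
theorem sum_primesLE_a_mul_log_le (A : SieveSequence) {y : ℝ} (hy : 1 ≤ y) :
    ∑ p ∈ Nat.primesLE ⌊y⌋₊, A.a p * Real.log p ≤ Real.log y * A.congrSum 1 y := by
  have hlogy : 0 ≤ Real.log y := Real.log_nonneg hy
  calc ∑ p ∈ Nat.primesLE ⌊y⌋₊, A.a p * Real.log p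
      ≤ ∑ p ∈ Nat.primesLE ⌊y⌋₊, A.a p * Real.log y := by
        refine Finset.sum_le_sum fun p hp => ?_
        obtain ⟨hpy, hpp⟩ := Nat.mem_primesLE.mp hp
        refine mul_le_mul_of_nonneg_left (Real.log_le_log ?_ ?_) (A.a_nonneg p)
        · exact_mod_cast hpp.pos
        · exact (Nat.cast_le.mpr hpy).trans (Nat.floor_le (by linarith))
    _ = Real.log y * ∑ p ∈ Nat.primesLE ⌊y⌋₊, A.a p := by rw [Finset.mul_sum]; simp_rw [mul_comm]
    _ ≤ Real.log y * A.congrSum 1 y := by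
        refine mul_le_mul_of_nonneg_left ?_ hlogy
        refine Finset.sum_le_sum_of_subset_of_nonneg (fun p hp => ?_) fun n _ _ => A.a_nonneg n
        obtain ⟨hpy, hpp⟩ := Nat.mem_primesLE.mp hp
        exact Finset.mem_filter.mpr ⟨Finset.mem_Ioc.mpr ⟨hpp.pos, hpy⟩, one_dvd p⟩

/-- Under the squarefree-support clause (1.16), `a_n Λ(n) = a_n log n` if `n` is prime and `0`
otherwise (proper prime powers are not squarefree). [cite: FriedlanderIwaniecASP1998, (1.16)] -/
theorem FIAsymptoticSieveHypotheses.a_mul_vonMangoldt (h : A.FIAsymptoticSieveHypotheses D δ Δ)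
    (n : ℕ) : A.a n * Λ n = if n.Prime then A.a n * Real.log n else 0 := by
  by_cases hp : n.Prime
  · rw [if_pos hp, ArithmeticFunction.vonMangoldt_apply_prime hp]
  rw [if_neg hp]
  by_cases hsq : Squarefree n
  · have hnpp : ¬IsPrimePow n := by
      rintro hpp
      obtain ⟨p, k, hpprime, hk, rfl⟩ := (isPrimePow_nat_iff _).mp hpp
      rcases Nat.lt_or_ge k 2 with hk2 | hk2
      · obtain rfl : k = 1 := by omega
        exact hp (by simpa using hpprime)
      · have hdvd : p * p ∣ p ^ k := by
          rw [← sq]; exact pow_dvd_pow p hk2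
        have := Nat.isUnit_iff.mp (hsq p hdvd)
        exact hpprime.one_lt.ne' this
    rw [ArithmeticFunction.vonMangoldt_eq_zero_iff.mpr hnpp, mul_zero]
  · rw [h.a_eq_zero hsq, zero_mul]

/-- `∑_{0 < n ≤ N} a_n Λ(n) = ∑_{p ≤ N} a_p log p` under (1.16). [cite: FriedlanderIwaniecASP1998, (1.16)] -/
theorem FIAsymptoticSieveHypotheses.sum_Ioc_a_mul_vonMangoldt
    (h : A.FIAsymptoticSieveHypotheses D δ Δ) (N : ℕ) :
    ∑ n ∈ Ioc 0 N, A.a n * Λ n = ∑ p ∈ Nat.primesLE N, A.a p * Real.log p := by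
  have h1 : ∑ n ∈ Finset.range (N + 1), A.a n * Λ n = ∑ n ∈ Ioc 0 N, A.a n * Λ n := by
    rw [Finset.range_eq_Ico, Finset.sum_eq_sum_Ico_succ_bot (Nat.succ_pos N),
      ArithmeticFunction.map_zero, mul_zero, zero_add]
    congr 1
  rw [← h1, Nat.primesLE_eq_filter_range, Finset.sum_filter]
  exact Finset.sum_congr rfl fun n _ => h.a_mul_vonMangoldt n

/-- **From primes to the tail of `∑ a_n Λ(n)`** (Harman, *Prime-Detecting Sieves*, p. 250, first
display; FI §3): under `FIAsymptoticSieveHypotheses` (only `size_eq`, (1.4) and (1.16) are used),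
for any cut-off `0 ≤ Z(x) ≤ √x`,
`∑_{p ≤ x} a_p log p - ∑_{Z(x) < n ≤ x} a_n Λ(n) = ∑_{p ≤ Z(x)} a_p log p ≤ ½ log x · A(√x)
  = O(A(x) / log x)`. [cite: Harman2007, §12.9 p. 250] -/
theorem FIAsymptoticSieveHypotheses.isBigO_sum_primes_sub_tail
    (h : A.FIAsymptoticSieveHypotheses D δ Δ) {Z : ℝ → ℝ}
    (hZ0 : ∀ᶠ x in atTop, 0 ≤ Z x) (hZ : ∀ᶠ x in atTop, Z x ≤ Real.sqrt x) :
    (fun x : ℝ => (∑ p ∈ Nat.primesLE ⌊x⌋₊, A.a p * Real.log p) -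
        ∑ n ∈ Ioc ⌊Z x⌋₊ ⌊x⌋₊, A.a n * Λ n) =O[atTop]
      fun x : ℝ => A.size x / Real.log x := by
  obtain ⟨c, hc, h14⟩ := h.2.1
  refine IsBigO.of_bound (1 / (2 * c)) ?_
  filter_upwards [h14, hZ0, hZ, eventually_gt_atTop 1] with x hx14 hx0 hxZ hx1
  have hx0' : 0 ≤ x := by linarith
  have hlogx : 0 < Real.log x := Real.log_pos hx1
  have hsqrt_le : Real.sqrt x ≤ x := by
    rw [Real.sqrt_le_left hx0']
    nlinarith
  have hZx : Z x ≤ x := hxZ.trans hsqrt_le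
  have hfloor : ⌊Z x⌋₊ ≤ ⌊x⌋₊ := Nat.floor_le_floor hZx
  -- the difference is the sum over primes `≤ Z`
  have hdiff : (∑ p ∈ Nat.primesLE ⌊x⌋₊, A.a p * Real.log p) -
      ∑ n ∈ Ioc ⌊Z x⌋₊ ⌊x⌋₊, A.a n * Λ n = ∑ p ∈ Nat.primesLE ⌊Z x⌋₊, A.a p * Real.log p := by
    rw [← h.sum_Ioc_a_mul_vonMangoldt, ← h.sum_Ioc_a_mul_vonMangoldt,
      ← Finset.sum_Ioc_consecutive _ (Nat.zero_le _) hfloor]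
    ring
  have hU0 : 0 ≤ ∑ p ∈ Nat.primesLE ⌊Z x⌋₊, A.a p * Real.log p :=
    Finset.sum_nonneg fun p hp => mul_nonneg (A.a_nonneg p)
      (Real.log_nonneg (by exact_mod_cast (Nat.prime_of_mem_primesLE hp).one_lt.le))
  have hsize0 : 0 ≤ A.size x := by rw [h.size_eq]; exact A.congrSum_nonneg 1 x
  rw [hdiff, Real.norm_eq_abs, Real.norm_eq_abs, abs_of_nonneg hU0,
    abs_of_nonneg (div_nonneg hsize0 hlogx.le)]
  -- (1.4): `A(√x) ≤ A(x) / (c (log x)²)`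
  have hAsqrt : A.size (Real.sqrt x) ≤ A.size x / (c * Real.log x ^ 2) := by
    rw [le_div_iff₀ (by positivity)]
    linarith
  have hAsqrt0 : 0 ≤ A.size (Real.sqrt x) := by rw [h.size_eq]; exact A.congrSum_nonneg 1 _
  by_cases hZ1 : 1 ≤ Z x
  · have hZpos : 0 < Z x := by linarith
    calc ∑ p ∈ Nat.primesLE ⌊Z x⌋₊, A.a p * Real.log p
        ≤ Real.log (Z x) * A.congrSum 1 (Z x) := A.sum_primesLE_a_mul_log_le hZ1
      _ ≤ (Real.log x / 2) * A.size (Real.sqrt x) := by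
          rw [h.size_eq]
          refine mul_le_mul ?_ (A.congrSum_mono 1 hxZ) (A.congrSum_nonneg 1 _)
            (by linarith)
          rw [← Real.log_sqrt hx0']
          exact Real.log_le_log hZpos hxZ
      _ ≤ (Real.log x / 2) * (A.size x / (c * Real.log x ^ 2)) :=
          mul_le_mul_of_nonneg_left hAsqrt (by linarith)
      _ = 1 / (2 * c) * (A.size x / Real.log x) := by
          field_simp
  · have hZlt : Z x < 1 := lt_of_not_ge hZ1
    have : ⌊Z x⌋₊ = 0 := Nat.floor_eq_zero.mpr hZlt
    rw [this, Nat.primesLE_zero, Finset.sum_empty]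
    exact mul_nonneg (by positivity) (div_nonneg hsize0 hlogx.le)

end SieveSequence

end Literature.NumberTheory.Sieve
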